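import Literature.AlgebraicGeometry.Resolution.KnafKuhlmann2009Leaves
import Literature.AlgebraicGeometry.Resolution.SeparablyDefectlessRationalVTHolds
import Literature.AlgebraicGeometry.Resolution.SeparablyDefectlessRationalRTProofs
import Literature.AlgebraicGeometry.Resolution.GeneralizedStabilityHolds
import Literature.AlgebraicGeometry.Resolution.KuhlmannVlahuThm111
import HarnessLib

/-!
# Knaf–Kuhlmann 2009, Thm. 1.2 (`KnafKuhlmann2009_Thm12`): what its discharge now rests on

Topic: `Literature/AlgebraicGeometry/Resolution`. Bookkeeping for the named fact
`KnafKuhlmann2009_Thm12` (`SmoothUniformization.lean`) = H. Knaf, F.-V. Kuhlmann, *Every place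
admits local uniformization in a finite extension of the function field*, Adv. Math. 221 (2009)
428–453 = arXiv:math/0702856, **Thm. 1.2** (first paragraph, as printed), and for the weak form
`KnafKuhlmann2009` (`LocalUniformization.lean`). `KnafKuhlmann2009Leaves.lean` proved both from
four named facts; three of them are now DISCHARGED in the tree:

* `Kuhlmann2010Stability_holds` (`GeneralizedStabilityHolds.lean`) — the generalized stability
  theorem over a trivially valued ground field (Kuhlmann 2010, Thm. 1.1);
* `Kuhlmann2010SeparablyDefectlessRational_sepClosed_holds`
  (`SeparablyDefectlessRationalVTHolds.lean`) and
  `Kuhlmann2010SeparablyDefectlessRationalRT_sepClosed_holds`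
  (`SeparablyDefectlessRationalRTProofs.lean`) — the "separably defectless" clause of that
  theorem for `K(x)` over a separably closed `K`, `x` value- resp. residue-transcendental;

and the fourth, `Kuhlmann2019_Prop52_sepClosed` (Kuhlmann 2019, Prop. 5.2: henselian
rationality in rank one over separable-algebraically closed fields), is reduced
(`Kuhlmann2019_Prop52_sepClosed.of_degreeP_step`, `KuhlmannVlahuThm111.lean`, with
`Kuhlmann2019Prop52Reduction.lean`) to the degree-`p` step `(hstep)` = Kuhlmann 2019,
Props. 4.8/4.9 (the Artin–Schreier and Kummer normal forms of §4 for a separable-algebraically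
closed `K` of rank one). This file records:

* `KnafKuhlmann2009_Thm12.of_prop52`, `KnafKuhlmann2009.of_prop52` — Thm. 1.2 from Prop. 5.2
  of Kuhlmann 2019 alone;
* `KnafKuhlmann2009_Thm12.of_degreeP_step`, `KnafKuhlmann2009.of_degreeP_step` — Thm. 1.2 from
  `(hstep)` alone: the remaining trust base of the discharge `KnafKuhlmann2009_Thm12_holds`
  along the printed proofs.

No definitions, no named facts; PROVED composition only.

## Sources

* [KK09] H. Knaf, F.-V. Kuhlmann, Adv. Math. 221 (2009) = arXiv:math/0702856: Thm. 1.2.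
  [KnafKuhlmann2009]
* [K19] F.-V. Kuhlmann, Israel J. Math. 234 (2019) = arXiv:1701.05508: Props. 4.8, 4.9, 5.2.
  [Kuhlmann2019]
-/

noncomputable section

namespace Literature.AlgebraicGeometry.Resolution

universe u

/-- **Knaf–Kuhlmann 2009, Thm. 1.2 (as printed, `KnafKuhlmann2009_Thm12`) from Kuhlmann 2019,
Prop. 5.2 alone** — the other three leaves of `KnafKuhlmann2009_Thm12.of_leaves` being
discharged. PROVED. [cite: KnafKuhlmann2009, Thm. 1.2] -/
theorem KnafKuhlmann2009_Thm12.of_prop52 (h52 : Kuhlmann2019_Prop52_sepClosed.{u}) :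
    KnafKuhlmann2009_Thm12.{u} :=
  KnafKuhlmann2009_Thm12.of_leaves h52 Kuhlmann2010SeparablyDefectlessRational_sepClosed_holds
    Kuhlmann2010SeparablyDefectlessRationalRT_sepClosed_holds Kuhlmann2010Stability_holds

/-- **The named fact `KnafKuhlmann2009` from Kuhlmann 2019, Prop. 5.2 alone.** PROVED.
[cite: KnafKuhlmann2009, Thm. 1.2] -/
theorem KnafKuhlmann2009.of_prop52 (h52 : Kuhlmann2019_Prop52_sepClosed.{u}) :
    KnafKuhlmann2009.{u} :=
  KnafKuhlmann2009.of_leaves h52 Kuhlmann2010SeparablyDefectlessRational_sepClosed_holds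
    Kuhlmann2010SeparablyDefectlessRationalRT_sepClosed_holds Kuhlmann2010Stability_holds

/-- **Knaf–Kuhlmann 2009, Thm. 1.2 (as printed) from the degree-`p` step `(hstep)` of Kuhlmann
2019, Prop. 5.2 alone** (`(hstep)` = Props. 4.8/4.9 of Kuhlmann 2019 for a
separable-algebraically closed `K` of rank one, verbatim as in
`Kuhlmann2019_Prop52_sepClosed.of_degreeP_steps`): the remaining trust base of
`KnafKuhlmann2009_Thm12_holds`. PROVED. [cite: KnafKuhlmann2009, Thm. 1.2] -/
theorem KnafKuhlmann2009_Thm12.of_degreeP_step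
    (hstep : ∀ (Ω : Type u) [Field Ω] [IsAlgClosed Ω] (V : ValuationSubring Ω) (p : ℕ)
      [CharP (IsLocalRing.ResidueField V) p], p.Prime → ∀ (K : Subfield Ω) (y : Ω) (E : Subfield Ω),
      IsSepClosed K → IsRankOne V K → Transcendental K y →
      IsImmediateOver V K (Subfield.closure ((K : Set Ω) ∪ {y})) →
      IsGaloisStep p (henselization V (Subfield.closure ((K : Set Ω) ∪ {y}))) E →
      ∃ ϑ ∈ E, E = henselization V (Subfield.closure ((K : Set Ω) ∪ {ϑ}))) :
    KnafKuhlmann2009_Thm12.{u} :=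
  KnafKuhlmann2009_Thm12.of_prop52 (Kuhlmann2019_Prop52_sepClosed.of_degreeP_step hstep)

/-- **The named fact `KnafKuhlmann2009` from the degree-`p` step `(hstep)` alone.** PROVED.
[cite: KnafKuhlmann2009, Thm. 1.2] -/
theorem KnafKuhlmann2009.of_degreeP_step
    (hstep : ∀ (Ω : Type u) [Field Ω] [IsAlgClosed Ω] (V : ValuationSubring Ω) (p : ℕ)
      [CharP (IsLocalRing.ResidueField V) p], p.Prime → ∀ (K : Subfield Ω) (y : Ω) (E : Subfield Ω),
      IsSepClosed K → IsRankOne V K → Transcendental K y →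
      IsImmediateOver V K (Subfield.closure ((K : Set Ω) ∪ {y})) →
      IsGaloisStep p (henselization V (Subfield.closure ((K : Set Ω) ∪ {y}))) E →
      ∃ ϑ ∈ E, E = henselization V (Subfield.closure ((K : Set Ω) ∪ {ϑ}))) :
    KnafKuhlmann2009.{u} :=
  KnafKuhlmann2009.of_prop52 (Kuhlmann2019_Prop52_sepClosed.of_degreeP_step hstep)

end Literature.AlgebraicGeometry.Resolution

end
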